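import Summits.QuantumFields.BalabanUV.Beta.GAN24.TwoLegChainKing

/-!
# `BalabanUV.Beta.GAN24.LegUnitKernelKing` — binder row G-an2-4 ∕ (CONV-C), route R7, road P2: LEGS ARE A RIGHT MODULE OVER UNIT-LATTICE
# (CONV-C) KERNELS — if a fine-leg family `P` (block decay `CP`, parent law `ρP` against King's parent) is composed on its unit-lattice
# index with a unit-lattice kernel `U` (decay `CU`, one-step `σU`), the composite leg `(P·U)(x,i;s) = Σ_q P(x,i;q)·U(q,s)` is again a leg with
# DISPLAYED letters: decay `(d+1)·CP·CU·latticeConst(δ∕2)` at rate `δ∕2`, parent law `(d+1)·(ρP·CU′ + CP·σU)·latticeConst(δ∕2)` — so hard legs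
# `H_k·c_k⁻¹`-type, dressed legs `𝒢Q*·Γ`, … inherit the two (CONV-C) clauses from their factors and feed `TwoLegChainKing.chain2` directly

NOT IN PRINT; OUR PROOF ATTEMPT (unit `b2b-balaban-gan24-p2`, gen 31 = prover-b2b-balaban-gan24-p2-g31-0, road-P2 chair of row G-an2-4;
CRUX TEAM (2) under the ruling «YM REDIRECT TOWARDS THE SUMMIT», 2026-08-21).  HONEST FRAMING (cell contract, verbatim): «discharging
`BetaPertH` makes Bałaban's UV stability UNCONDITIONAL — a real constructive-QFT result; it is NOT the continuum limit and NOT the Clay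
problem.»  HONEST DEPENDENCY (verbatim): «continuum YM on T⁴ ⇐ BetaPertH ∧ nine spine estimates (0/9 proved); BetaPertH ⇐ (D1) ∧ (D4) ∧
CAP+tail; G-an2-4 gates asym, D1 and NE2/3/4.»  ABSOLUTE RULE: nothing printed is a hypothesis; no `def … : Prop`, no `sorry`; [folklore]
finite sums BY NAME (`GradientVertexChainKing.sum_exp_two_centre_le`).  Pure bookkeeping: every analytic input is a displayed letter.

## Content (0 sorry; torus model, dimension `d+1 ≥ 1`, every period vector `M`)
 * §1 `legMulUnit P U x i s := Σ_{q : Src M} P x i q · U q s`.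
 * §2 **`norm_legMulUnit_le`** (DECAY): `|P(x,i;(y,λ))| ≤ CP·e^{−δ|ȳ(x)−y|}`, `|U((t,λ),(y,λ′))| ≤ CU·e^{−δ|rep t − y|}` ⇒
   `|(P·U)(x,i;(y,λ′))| ≤ (d+1)·CP·CU·latticeConst(d+1,δ∕2)·e^{−(δ∕2)|ȳ(x)−y|_T}`.
 * §3 **`norm_legMulUnit_sub_le`** (PARENT LAW, general `N, R`): with `|P′(x′) − P(par x′)| ≤ ρP·e^{…}`, `|U′ − U| ≤ σU·e^{…}`, `|U′| ≤ CU`, `|P∘par| ≤ CP`: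
   `|(P′·U′)(x′,i;s) − (P·U)(par x′,i;s)| ≤ (d+1)·(ρP·CU + CP·σU)·latticeConst(d+1,δ∕2)·e^{−(δ∕2)|ȳ(x′)−y|_T}` (Leibniz `(P′−P∘par)U′ + (P∘par)(U′−U)`).
HONEST.  [folklore]; no analysis; U = 1 vocabulary of the b05 lineage (`Tor`, `blockOf`, `rep`, `par`); NOT (CONV-C) as a whole, NEVER «G-an2-4
closed», NOT NE2, NOT D1, NOT BetaPertH, NOT continuum, NOT Clay.  Text locations only: [King1986] §4 p. 672 (Leibniz mechanism).
-/

noncomputable section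

open scoped BigOperators
open Finset

namespace Summit.QuantumFields.BalabanUV.Beta.GAN24.LegUnitKernelKing

open Literature.MathematicalPhysics.QuantumFieldTheory.Balaban1983to89
open Literature.MathematicalPhysics.QuantumFieldTheory.Balaban1983to89.B5Prop11Plancherel (Tor fine)
open Literature.MathematicalPhysics.QuantumFieldTheory.Balaban1983to89.B4TorusKernel.MultiPeriod (torusSupNorm)
open Literature.MathematicalPhysics.QuantumFieldTheory.Balaban1983to89.B4Sect5Proof (latticeConst latticeConst_nonneg)
open Literature.MathematicalPhysics.QuantumFieldTheory.Balaban1983to89.B5Blocks16 (blockOf)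
open Literature.MathematicalPhysics.QuantumFieldTheory.Balaban1983to89.B6LowerBound2153Torus (toT rep toT_rep)
open Summit.QuantumFields.BalabanUV.T4Continuum.BalabanAveragedTowerModes (par)
open Summit.QuantumFields.BalabanUV.Beta.GAN24.GradientVertexChainKing (sum_exp_two_centre_le)
open Summit.QuantumFields.BalabanUV.Beta.GAN24.TwoLegChainKing (Src)

variable {d : ℕ} {ι : Type*}

/-! ## §1 Composition of a fine leg with a unit-lattice kernel -/

section Defs

variable {n : ℕ} (M : Fin (d + 1) → ℕ) [hM : ∀ μ, NeZero (M μ)]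

/-- **the composite leg** `(P·U)(x,i;s) = Σ_{q} P(x,i;q)·U(q,s)` (right action of a unit-lattice kernel on the leg's unit index). [folklore] -/
def legMulUnit (P : Tor (fine n M) → ι → Src M → ℂ) (U : Src M → Src M → ℂ) (x : Tor (fine n M)) (i : ι) (s : Src M) : ℂ :=
  ∑ q : Src M, P x i q * U q s

end Defs

/-! ## §2 The decay letter of the composite leg -/

section Decay

variable {n : ℕ} [NeZero n] (M : Fin (d + 1) → ℕ) [hM : ∀ μ, NeZero (M μ)]

/-- the unit-index sum of a two-centre product: `Σ_{q=(t,λ)} a·e^{−δ|z − rep t|}·(b·e^{−δ|rep t − y|}) ≤ (d+1)·a·b·latticeConst(δ∕2)·e^{−(δ∕2)|z−y|}`. [folklore] -/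
theorem sum_src_two_centre_le {δ a b : ℝ} (hδ : 0 < δ) (ha : 0 ≤ a) (hb : 0 ≤ b) (z y : Fin (d + 1) → ℤ) :
    ∑ q : Src M, a * Real.exp (-(δ * torusSupNorm M (z - rep M q.1))) * (b * Real.exp (-(δ * torusSupNorm M (rep M q.1 - y))))
      ≤ ((d : ℝ) + 1) * a * b * latticeConst (d + 1) (δ / 2) * Real.exp (-(δ / 2 * torusSupNorm M (z - y))) := by
  have h2 := sum_exp_two_centre_le M hδ z y
  have hsym : ∀ t : Tor M, torusSupNorm M (z - rep M t) = torusSupNorm M (rep M t - z) := fun t => by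
    rw [← T4EtaRateOperatorTorus.torusSupNorm_neg M (z - rep M t), neg_sub]
  rw [Fintype.sum_prod_type]
  simp only [Finset.sum_const, Finset.card_univ, Fintype.card_fin, nsmul_eq_mul]
  calc ∑ t : Tor M, ((d + 1 : ℕ) : ℝ) * (a * Real.exp (-(δ * torusSupNorm M (z - rep M t))) * (b * Real.exp (-(δ * torusSupNorm M (rep M t - y)))))
      = ((d : ℝ) + 1) * a * b * ∑ t : Tor M, Real.exp (-(δ * torusSupNorm M (rep M t - z))) * Real.exp (-(δ * torusSupNorm M (rep M t - y))) := by
        rw [Finset.mul_sum]; refine Finset.sum_congr rfl fun t _ => ?_; rw [hsym t]; push_cast; ring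
    _ ≤ ((d : ℝ) + 1) * a * b * (latticeConst (d + 1) (δ / 2) * Real.exp (-(δ / 2 * torusSupNorm M (z - y)))) :=
        mul_le_mul_of_nonneg_left h2 (by positivity)
    _ = _ := by ring

/-- **THE DECAY LETTER OF THE COMPOSITE LEG**: block-decaying `P` (`CP`, rate `δ`) and a decaying unit kernel `U` (`CU`, rate `δ`) give
`|(P·U)(x,i;(y,λ′))| ≤ (d+1)·CP·CU·latticeConst(d+1,δ∕2)·e^{−(δ∕2)|ȳ(x) − y|_T}`. [folklore] -/
theorem norm_legMulUnit_le (P : Tor (fine n M) → ι → Src M → ℂ) (U : Src M → Src M → ℂ) {CP CU δ : ℝ} (hδ : 0 < δ) (hCP : 0 ≤ CP)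
    (hCU : 0 ≤ CU)
    (hP : ∀ x i (y : Fin (d + 1) → ℤ) lam, ‖P x i (toT M y, lam)‖ ≤ CP * Real.exp (-(δ * torusSupNorm M (rep M (blockOf n M x) - y))))
    (hU : ∀ (q : Src M) (y : Fin (d + 1) → ℤ) lam, ‖U q (toT M y, lam)‖ ≤ CU * Real.exp (-(δ * torusSupNorm M (rep M q.1 - y))))
    (x : Tor (fine n M)) (i : ι) (y : Fin (d + 1) → ℤ) (lam : Fin (d + 1)) :
    ‖legMulUnit M P U x i (toT M y, lam)‖
      ≤ ((d : ℝ) + 1) * CP * CU * latticeConst (d + 1) (δ / 2) * Real.exp (-(δ / 2 * torusSupNorm M (rep M (blockOf n M x) - y))) := by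
  unfold legMulUnit
  set z := rep M (blockOf n M x)
  calc _ ≤ ∑ q : Src M, ‖P x i q * U q (toT M y, lam)‖ := norm_sum_le _ _
    _ ≤ ∑ q : Src M, CP * Real.exp (-(δ * torusSupNorm M (z - rep M q.1))) * (CU * Real.exp (-(δ * torusSupNorm M (rep M q.1 - y)))) := by
        refine Finset.sum_le_sum fun q _ => ?_
        rw [norm_mul]
        have hq : q = (toT M (rep M q.1), q.2) := by rw [toT_rep]
        have hP' := hP x i (rep M q.1) q.2
        rw [← hq] at hP'
        exact mul_le_mul hP' (hU q y lam) (norm_nonneg _) (mul_nonneg hCP (Real.exp_pos _).le)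
    _ ≤ _ := sum_src_two_centre_le M hδ hCP hCU z y

end Decay

/-! ## §3 The parent law of the composite leg -/

section Step

variable {N R : ℕ} [NeZero N] [NeZero R] (M : Fin (d + 1) → ℕ) [hM : ∀ μ, NeZero (M μ)]

/-- **THE PARENT LAW OF THE COMPOSITE LEG** (general `N, R`, every torus): with `|P′(x′) − P(par x′)| ≤ ρP·e^{−δ|ȳ(x′)−y|}`, `|P(par x′)| ≤ CP·e^{…}`,
`|U′(q,s) − U(q,s)| ≤ σU·e^{−δ|q−s|}`, `|U′(q,s)| ≤ CU·e^{−δ|q−s|}`: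
`|(P′·U′)(x′,i;s) − (P·U)(par x′,i;s)| ≤ (d+1)·(ρP·CU + CP·σU)·latticeConst(d+1,δ∕2)·e^{−(δ∕2)|ȳ(x′)−y|_T}`. [cite: King1986, §4 p.672 (Leibniz)] [folklore] -/
theorem norm_legMulUnit_sub_le (P' : Tor (fine (R * N) M) → ι → Src M → ℂ) (P : Tor (fine N M) → ι → Src M → ℂ)
    (U' U : Src M → Src M → ℂ) {CP CU ρP σU δ : ℝ} (hδ : 0 < δ) (hCP : 0 ≤ CP) (hCU : 0 ≤ CU) (hρP : 0 ≤ ρP) (hσU : 0 ≤ σU)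
    (hP : ∀ (x' : Tor (fine (R * N) M)) i (y : Fin (d + 1) → ℤ) lam,
      ‖P (par N R M x') i (toT M y, lam)‖ ≤ CP * Real.exp (-(δ * torusSupNorm M (rep M (blockOf (R * N) M x') - y))))
    (hdP : ∀ (x' : Tor (fine (R * N) M)) i (y : Fin (d + 1) → ℤ) lam,
      ‖P' x' i (toT M y, lam) - P (par N R M x') i (toT M y, lam)‖ ≤ ρP * Real.exp (-(δ * torusSupNorm M (rep M (blockOf (R * N) M x') - y))))
    (hU' : ∀ (q : Src M) (y : Fin (d + 1) → ℤ) lam, ‖U' q (toT M y, lam)‖ ≤ CU * Real.exp (-(δ * torusSupNorm M (rep M q.1 - y))))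
    (hdU : ∀ (q : Src M) (y : Fin (d + 1) → ℤ) lam, ‖U' q (toT M y, lam) - U q (toT M y, lam)‖ ≤ σU * Real.exp (-(δ * torusSupNorm M (rep M q.1 - y))))
    (x' : Tor (fine (R * N) M)) (i : ι) (y : Fin (d + 1) → ℤ) (lam : Fin (d + 1)) :
    ‖legMulUnit M P' U' x' i (toT M y, lam) - legMulUnit M P U (par N R M x') i (toT M y, lam)‖
      ≤ ((d : ℝ) + 1) * (ρP * CU + CP * σU) * latticeConst (d + 1) (δ / 2) *
          Real.exp (-(δ / 2 * torusSupNorm M (rep M (blockOf (R * N) M x') - y))) := by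
  unfold legMulUnit
  set z := rep M (blockOf (R * N) M x')
  rw [← Finset.sum_sub_distrib]
  have hterm : ∀ q : Src M, ‖P' x' i q * U' q (toT M y, lam) - P (par N R M x') i q * U q (toT M y, lam)‖
      ≤ (ρP * CU + CP * σU) * Real.exp (-(δ * torusSupNorm M (z - rep M q.1))) * (1 * Real.exp (-(δ * torusSupNorm M (rep M q.1 - y)))) := by
    intro q
    have hq : q = (toT M (rep M q.1), q.2) := by rw [toT_rep]
    have h1 := hdP x' i (rep M q.1) q.2
    have h2 := hP x' i (rep M q.1) q.2
    rw [← hq] at h1 h2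
    have h3 := hU' q y lam
    have h4 := hdU q y lam
    set E := Real.exp (-(δ * torusSupNorm M (z - rep M q.1)))
    set E' := Real.exp (-(δ * torusSupNorm M (rep M q.1 - y)))
    have e : P' x' i q * U' q (toT M y, lam) - P (par N R M x') i q * U q (toT M y, lam)
        = (P' x' i q - P (par N R M x') i q) * U' q (toT M y, lam) + P (par N R M x') i q * (U' q (toT M y, lam) - U q (toT M y, lam)) := by ring
    rw [e]
    calc _ ≤ ‖(P' x' i q - P (par N R M x') i q) * U' q (toT M y, lam)‖ + ‖P (par N R M x') i q * (U' q (toT M y, lam) - U q (toT M y, lam))‖ :=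
          norm_add_le _ _
      _ ≤ (ρP * E) * (CU * E') + (CP * E) * (σU * E') := by
          rw [norm_mul, norm_mul]
          exact add_le_add (mul_le_mul h1 h3 (norm_nonneg _) (mul_nonneg hρP (Real.exp_pos _).le))
            (mul_le_mul h2 h4 (norm_nonneg _) (mul_nonneg hCP (Real.exp_pos _).le))
      _ = _ := by ring
  calc _ ≤ ∑ q : Src M, ‖P' x' i q * U' q (toT M y, lam) - P (par N R M x') i q * U q (toT M y, lam)‖ := norm_sum_le _ _
    _ ≤ ∑ q : Src M, (ρP * CU + CP * σU) * Real.exp (-(δ * torusSupNorm M (z - rep M q.1))) * (1 * Real.exp (-(δ * torusSupNorm M (rep M q.1 - y)))) :=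
        Finset.sum_le_sum fun q _ => hterm q
    _ ≤ ((d : ℝ) + 1) * (ρP * CU + CP * σU) * 1 * latticeConst (d + 1) (δ / 2) * Real.exp (-(δ / 2 * torusSupNorm M (z - y))) :=
        sum_src_two_centre_le M hδ (by positivity) zero_le_one z y
    _ = ((d : ℝ) + 1) * (ρP * CU + CP * σU) * latticeConst (d + 1) (δ / 2) * Real.exp (-(δ / 2 * torusSupNorm M (z - y))) := by ring

end Step

end Summit.QuantumFields.BalabanUV.Beta.GAN24.LegUnitKernelKing

end
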